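import Mathlib
import HarnessLib
import Summits.HubbardSuperconductivity.HubbardSuperconductivity.Theorems.KLProgrammeKLRegimeSplitFrameExtFnSymmetric
import Summits.HubbardSuperconductivity.HubbardSuperconductivity.Theorems.KLProgrammeKLRegimeSplitCompGradedBounds
import Summits.HubbardSuperconductivity.HubbardSuperconductivity.Theorems.KLProgrammeKLRegimeCountertermJacksonRemainderCertAnalyticCutoff
import Summits.HubbardSuperconductivity.HubbardSuperconductivity.Theorems.KLProgrammeKLRegimeCountertermJacksonRemainderFlowSizes

/-!
# (C1) JACKSON REMAINDER AT DEEP SCALES — GRADED GLOBAL sizes of the G-extension (the far rows' `B i`, structured in the reading's jets)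

Cell `gate-hubbard-kl`, seat hubbard-kl-k3c3-p3 (g11), `--supports stmt-HubbardSuperconductivity-20437` (stub (C) of `KLRegimeEngineV17F2`); pen (R79)
«(C1)-DEEP analytic supplier».  Memo `HOME/hubbard-kl-k3c3-p3/C1-JETBOX-DEEP.md` §6(i) (located design fact «FAR-ROWS-STRUCTURED»).

The graded one-call door `flowPiece_reading_remainder_jets_meanFree_bell` (…JacksonRemainderOneCallGraded) takes GLOBAL sizes `‖DⁱF₀‖ ≤ B i` of the
mean-free G-extension `F₀ = onM (E_μ(f − mean f))`; its FAR rows are `τ·(B l + Ml l)·Bell(D)`.  k3c3-p1's discharge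
`norm_iteratedFDeriv_onM_klFrameExtFn_le` is SINGLE-constant (`(i!)²(2·i!·X·200ⁱ)·G·(4 + max 1((i−1)!/1.6))ⁱ`, one `X` for every `χ₂`-order, one
`G` for every angular order): `B₄ ≈ 6·10²³·G`, so the far rows would clear the bars only from reading scale `≈ 14`.  This file proves the GRADED
discharge — Leibniz on the chart `{q ≠ 0}` with (a) the flat cutoff's per-order momentum numerals `X = (640/3, 1205120/9, 23040401280,
1512668168424320/9)` (…CertAnalyticCutoff `norm_iteratedFDeriv_klFlatCutoffFn_ofLp_le`; order `0`: `|χ| ≤ 1`) and (b) the Bell-graded angular sizes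
`b₁/r, (b₂+b₁)/r², (b₃+3b₂+2b₁)/r³, (b₄+6b₃+11b₂+6b₁)/r⁴` at `r = 8/5` (…CompGradedBounds `norm_iteratedFDeriv_comp_polarAngle_le_graded`; order `0`:
`|g| ≤ b₀`) — so that `B i = Σ_j C(i,j)·X_j·Ang_{i−j}(b)` is LINEAR in each angular jet size `b_l`:

* §1 `norm_iteratedFDeriv_flatSymbol_le_graded` (the product symbol `ψ_μ(ε)·g(θ)` at every momentum);
* §2 `norm_iteratedFDeriv_frameExtFn_le_of_symbolBound` (k3c3-p1's centring transport, made generic in the symbol bound) and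
  **`norm_iteratedFDeriv_onM_klFrameExtFn_meanFree_le_graded`** — the `hB` of the graded door, `B i = Σ_j C(i,j)·X_j·Ang_{i−j}(b)` written out.

Size check (memo §6(i)): the `a₀`-weighted top entry is `X₄·b₀ ≈ 1.7·10¹⁴·b₀` (not `6·10²³·G`); with the far mass `τ(d_n) ≍ 64^{−n}` and
`b₀ ≍ U²4^{−n}` the k = 4 far row of the graded door is `≈ 4.6·10¹³·c₁·4096^{−n}` of its bar with the crude `D₁ = 2(U₀+U₁)` — inside the bar from
reading scale `n+1 ≥ 7` (from `n+1 ≥ 6` with the honest `D₁ = √(u²+u′²)`); the scales `n+1 ≤ 5` are the certificate tables' (`d ≤ 32768`).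

Pure real analysis; no definitions; nothing about the Hubbard model.
-/

noncomputable section

namespace Summit.HubbardSuperconductivity.HubbardSuperconductivity.Theorems.KLRegimeSplit

set_option linter.dupNamespace false -- summit = problem name (single-conjunct summit), D-0017

open Real Finset Filter Literature.MathematicalPhysics.QuantumLattice
open scoped Topology

/-! ## §1 The graded symbol bound -/

section Symbol

variable {g : ℝ → ℝ}

/-- The flat-cutoff factor in the `100·(ε−μ)²` form IS `klFlatCutoffFn μ ∘ ofLp`. -/
theorem flatFactor_eq_klFlatCutoffFn (μ : ℝ) :
    (fun q : Momentum => 1 - salmhoferCutoff (100 * (sqDispersion (WithLp.ofLp q) - μ) ^ 2)) =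
      fun q : Momentum => klFlatCutoffFn μ (WithLp.ofLp q) := by
  funext q
  simp only [klFlatCutoffFn, freeBandFn_eq_sqDispersion, div_four_klFlatR_sq]

/-- **THE GRADED SYMBOL BOUND.**  For `g` `C⁴`, `2π`-periodic with `|g| ≤ b 0` and `‖Dᵏg‖ ≤ b k` (`1 ≤ k ≤ 4`), `μ ∈ klWindowC`, and every momentum
`q`, the product symbol `S₀(q) = (1 − χ₂(100(ε(q)−μ)²))·g(θ(q))` has, for `n ≤ 4`,
`‖DⁿS₀(q)‖ ≤ Σ_{i ≤ n} C(n,i)·X i·Ang (n−i)` with `X = (1, 640/3, 1205120/9, 23040401280, 1512668168424320/9)` and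
`Ang = (b 0, b 1/r, (b 2+b 1)/r², (b 3+3b 2+2b 1)/r³, (b 4+6b 3+11b 2+6b 1)/r⁴)`, `r = 8/5`. -/
theorem norm_iteratedFDeriv_flatSymbol_le_graded (hg : ContDiff ℝ 4 g) (hper : Function.Periodic g (2 * Real.pi)) {μ : ℝ}
    (hμ : μ ∈ klWindowC) {b : ℕ → ℝ} (hb0 : ∀ t, |g t| ≤ b 0) (hb : ∀ k, 1 ≤ k → k ≤ 4 → ∀ t, ‖iteratedFDeriv ℝ k g t‖ ≤ b k)
    {n : ℕ} (hn : n ≤ 4) (q : Momentum) :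
    ‖iteratedFDeriv ℝ n (fun q : Momentum => (1 - salmhoferCutoff (100 * (sqDispersion (WithLp.ofLp q) - μ) ^ 2)) *
        g (polarAngle (WithLp.ofLp q))) q‖ ≤
      ∑ i ∈ range (n + 1), (n.choose i : ℝ) *
        ((fun i : ℕ => if i = 0 then (1 : ℝ) else if i = 1 then 640 / 3 else if i = 2 then 1205120 / 9 else if i = 3 then 23040401280
          else 1512668168424320 / 9) i) *
        ((fun m : ℕ => if m = 0 then b 0 else if m = 1 then b 1 / (8 / 5) else if m = 2 then (b 2 + b 1) / (8 / 5) ^ 2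
          else if m = 3 then (b 3 + 3 * b 2 + 2 * b 1) / (8 / 5) ^ 3 else (b 4 + 6 * b 3 + 11 * b 2 + 6 * b 1) / (8 / 5) ^ 4) (n - i)) := by
  set X : ℕ → ℝ := fun i => if i = 0 then (1 : ℝ) else if i = 1 then 640 / 3 else if i = 2 then 1205120 / 9 else if i = 3 then 23040401280
    else 1512668168424320 / 9 with hX
  set Ang : ℕ → ℝ := fun m => if m = 0 then b 0 else if m = 1 then b 1 / (8 / 5) else if m = 2 then (b 2 + b 1) / (8 / 5) ^ 2
    else if m = 3 then (b 3 + 3 * b 2 + 2 * b 1) / (8 / 5) ^ 3 else (b 4 + 6 * b 3 + 11 * b 2 + 6 * b 1) / (8 / 5) ^ 4 with hAng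
  have hμ' := hμ
  simp only [klWindowC, Set.mem_Icc] at hμ'
  have hb00 : 0 ≤ b 0 := (abs_nonneg _).trans (hb0 0)
  have hb1 : 0 ≤ b 1 := (norm_nonneg _).trans (hb 1 le_rfl (by norm_num) 0)
  have hb2 : 0 ≤ b 2 := (norm_nonneg _).trans (hb 2 (by norm_num) (by norm_num) 0)
  have hb3 : 0 ≤ b 3 := (norm_nonneg _).trans (hb 3 (by norm_num) (by norm_num) 0)
  have hb4 : 0 ≤ b 4 := (norm_nonneg _).trans (hb 4 (by norm_num) le_rfl 0)
  have hX0 : ∀ i, 0 ≤ X i := fun i => by simp only [hX]; split_ifs <;> norm_num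
  have hAng0 : ∀ m, 0 ≤ Ang m := fun m => by simp only [hAng]; split_ifs <;> positivity
  have hsum0 : 0 ≤ ∑ i ∈ range (n + 1), (n.choose i : ℝ) * X i * Ang (n - i) :=
    sum_nonneg fun i _ => mul_nonneg (mul_nonneg (by positivity) (hX0 i)) (hAng0 _)
  -- off the support every derivative vanishes
  by_cases hq : 1 / 10 < |sqDispersion (WithLp.ofLp q) - μ|
  · rw [iteratedFDeriv_symbol_eq_zero_of_lt (ψ := fun u : ℝ => 1 - salmhoferCutoff (100 * (u - μ) ^ 2))
      (fun u hu => flatProfile_eq_zero_of_le hu) hq n, norm_zero]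
    exact hsum0
  -- on the support: away from the origin (`‖q‖ ≥ 8/5`)
  have hε : -4 + (8 / 5 : ℝ) ^ 2 ≤ sqDispersion (WithLp.ofLp q) := by
    have := abs_le.mp (not_lt.mp hq); nlinarith [this.1, hμ'.1]
  have hr : (0 : ℝ) < 8 / 5 := by norm_num
  have hrq : (8 / 5 : ℝ) ≤ ‖q‖ := le_norm_of_sqDispersion_ge hr.le hε
  have hq0 : q ≠ 0 := by intro h; rw [h, norm_zero] at hrq; norm_num at hrq
  -- the chart `{q ≠ 0}`
  set s : Set Momentum := {q | q ≠ 0} with hs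
  have hso : IsOpen s := isOpen_ne
  have hqs : q ∈ s := hq0
  set A : Momentum → ℝ := fun q => 1 - salmhoferCutoff (100 * (sqDispersion (WithLp.ofLp q) - μ) ^ 2) with hA
  set Bf : Momentum → ℝ := fun q => g (polarAngle (WithLp.ofLp q)) with hBf
  have hAeq : A = fun q : Momentum => klFlatCutoffFn μ (WithLp.ofLp q) := flatFactor_eq_klFlatCutoffFn μ
  have hAc : ContDiffOn ℝ 4 A s := by rw [hAeq]; exact (contDiff_klFlatCutoffFn_ofLp μ).contDiffOn
  have hBc : ContDiffOn ℝ 4 Bf s := fun q' hq' => (contDiffAt_comp_polarAngle_ofLp hg hper hq').contDiffWithinAt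
  have hLeib := norm_iteratedFDerivWithin_mul_le hAc hBc hso.uniqueDiffOn hqs (n := n) (by exact_mod_cast hn)
  rw [iteratedFDerivWithin_of_isOpen n hso hqs] at hLeib
  refine hLeib.trans (sum_le_sum fun i hi => ?_)
  have hin : i ≤ n := Nat.lt_succ_iff.mp (mem_range.mp hi)
  rw [iteratedFDerivWithin_of_isOpen i hso hqs, iteratedFDerivWithin_of_isOpen (n - i) hso hqs]
  -- the cutoff factor
  have hAi : ‖iteratedFDeriv ℝ i A q‖ ≤ X i := by
    rcases Nat.eq_zero_or_pos i with rfl | hipos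
    · rw [iteratedFDeriv_zero_eq_comp, Function.comp_apply, LinearIsometryEquiv.norm_map, Real.norm_eq_abs]
      have h01 := salmhoferCutoff_mem_Icc (100 * (sqDispersion (WithLp.ofLp q) - μ) ^ 2)
      have : X 0 = 1 := by simp [hX]
      rw [this, abs_le]; constructor <;> linarith [h01.1, h01.2]
    · rw [hAeq]
      have h := norm_iteratedFDeriv_klFlatCutoffFn_ofLp_le μ hipos (hin.trans hn) q
      refine h.trans (le_of_eq ?_)
      have hi0 : i ≠ 0 := by omega
      simp only [hX, hi0, ↓reduceIte]
  -- the angular factor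
  have hBi : ‖iteratedFDeriv ℝ (n - i) Bf q‖ ≤ Ang (n - i) := by
    rcases Nat.eq_zero_or_pos (n - i) with h0 | hpos
    · rw [h0, iteratedFDeriv_zero_eq_comp, Function.comp_apply, LinearIsometryEquiv.norm_map, Real.norm_eq_abs]
      have : Ang 0 = b 0 := by simp [hAng]
      rw [this]; exact hb0 _
    · obtain ⟨m1, m2, m3, m4⟩ := norm_iteratedFDeriv_comp_polarAngle_le_graded hg hper hr hrq hb
      have hle : n - i ≤ 4 := (Nat.sub_le n i).trans hn
      interval_cases hm : (n - i)
      · simpa [hAng] using m1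
      · simpa [hAng] using m2
      · simpa [hAng] using m3
      · simpa [hAng] using m4
  have hc0 : (0 : ℝ) ≤ (n.choose i : ℝ) := Nat.cast_nonneg _
  calc (n.choose i : ℝ) * ‖iteratedFDeriv ℝ i A q‖ * ‖iteratedFDeriv ℝ (n - i) Bf q‖
      ≤ (n.choose i : ℝ) * X i * Ang (n - i) :=
        mul_le_mul (mul_le_mul_of_nonneg_left hAi hc0) hBi (norm_nonneg _) (mul_nonneg hc0 (hX0 i))

end Symbol

/-! ## §2 The centring transport with a generic symbol bound, and the graded global sizes of the G-extension -/

section Main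

variable {f : ℝ → ℝ}

/-- **k3c3-p1's centring transport, generic in the symbol bound** (…SplitFrameExtFnBounds `norm_iteratedFDeriv_frameExtFn_le` with the explicit
table replaced by a hypothesis): if the product symbol `S₀ = ψ_μ(ε)·(f − m)(θ)` has `‖DⁿS₀‖ ≤ B` at EVERY momentum (`0 ≤ B`), then the de-interpolated
G-extension `q ↦ m + ψ_μ(ε(q))·(f(θ(q̃)) − m)` (`q̃` the centred representative) has `‖Dⁿ‖ ≤ [n = 0]·|m| + B` at every momentum. -/
theorem norm_iteratedFDeriv_frameExtFn_le_of_symbolBound {N : WithTop ℕ∞} (hf : ContDiff ℝ N f) (hper : Function.Periodic f (2 * Real.pi))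
    {n : ℕ} (hn : (n : WithTop ℕ∞) ≤ N) {m μ B : ℝ} (hμ : μ ∈ klWindowC) (hB0 : 0 ≤ B)
    (hS₀ : ∀ q' : Momentum, ‖iteratedFDeriv ℝ n (fun q' : Momentum =>
      (1 - salmhoferCutoff (100 * (sqDispersion (WithLp.ofLp q') - μ) ^ 2)) * (f (polarAngle (WithLp.ofLp q')) - m)) q'‖ ≤ B)
    (q : Momentum) :
    ‖iteratedFDeriv ℝ n (fun q : Momentum =>
        m + (1 - salmhoferCutoff ((sqDispersion (WithLp.ofLp q) - μ) ^ 2 / (4 * klFlatR ^ 2))) *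
          (f (polarAngle (fun i => toIocMod Real.two_pi_pos (-Real.pi) (WithLp.ofLp q i))) - m)) q‖ ≤
      (if n = 0 then |m| else 0) + B := by
  have hμ' := hμ
  simp only [klWindowC, Set.mem_Icc] at hμ'
  set g : ℝ → ℝ := fun t => f t - m with hg
  have hgc : ContDiff ℝ N g := hf.sub contDiff_const
  have hgp : Function.Periodic g (2 * Real.pi) := fun t => by simp [hg, hper t]
  have hfun : (fun q : Momentum =>
        m + (1 - salmhoferCutoff ((sqDispersion (WithLp.ofLp q) - μ) ^ 2 / (4 * klFlatR ^ 2))) *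
          (f (polarAngle (fun i => toIocMod Real.two_pi_pos (-Real.pi) (WithLp.ofLp q i))) - m)) =
      fun q : Momentum => m + (1 - salmhoferCutoff (100 * (sqDispersion (WithLp.ofLp q) - μ) ^ 2)) *
          g (polarAngle (fun i => toIocMod Real.two_pi_pos (-Real.pi) (WithLp.ofLp q i))) := by
    funext q'; rw [div_four_klFlatR_sq]
  rw [hfun]
  by_cases hW : 1 / 10 < |sqDispersion (WithLp.ofLp q) - μ|
  · have hopen : IsOpen {q' : Momentum | 1 / 10 < |sqDispersion (WithLp.ofLp q') - μ|} :=
      isOpen_lt continuous_const ((contDiff_sqDispersion_ofLp (N := 0)).continuous.sub continuous_const).abs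
    have hev : (fun q : Momentum => m + (1 - salmhoferCutoff (100 * (sqDispersion (WithLp.ofLp q) - μ) ^ 2)) *
          g (polarAngle (fun i => toIocMod Real.two_pi_pos (-Real.pi) (WithLp.ofLp q i)))) =ᶠ[𝓝 q]
        fun _ => m := by
      filter_upwards [hopen.mem_nhds hW] with q' hq'
      rw [flatProfile_eq_zero_of_le hq'.le, zero_mul, add_zero]
    rw [(hev.iteratedFDeriv ℝ n).eq_of_nhds]
    rcases Nat.eq_zero_or_pos n with rfl | hpos
    · simp only [iteratedFDeriv_zero_eq_comp, Function.comp_apply, LinearIsometryEquiv.norm_map, Real.norm_eq_abs,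
        if_true]
      linarith
    · rw [iteratedFDeriv_const_of_ne (by omega), Pi.zero_apply, norm_zero, if_neg (by omega), zero_add]
      exact hB0
  · have hεle : sqDispersion (WithLp.ofLp q) - μ ≤ 1 / 10 := (abs_le.mp (not_lt.mp hW)).2
    have hεge : -(1 / 10) ≤ sqDispersion (WithLp.ofLp q) - μ := (abs_le.mp (not_lt.mp hW)).1
    have hεneg : sqDispersion (WithLp.ofLp q) < 0 := by linarith
    have hne : ∀ i : Fin 2, toIocMod Real.two_pi_pos (-Real.pi) (WithLp.ofLp q i) ≠ -Real.pi + 2 * Real.pi := by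
      intro i h
      have h' : toIocMod Real.two_pi_pos (-Real.pi) (WithLp.ofLp q i) = Real.pi := by rw [h]; ring
      have hnn := sqDispersion_nonneg_of_coord_eq_pi (p := fun j => toIocMod Real.two_pi_pos (-Real.pi) (WithLp.ofLp q j))
        (i := i) h'
      rw [sqDispersion_centred] at hnn
      linarith
    set z : Fin 2 → ℤ := fun i => toIocDiv Real.two_pi_pos (-Real.pi) (WithLp.ofLp q i) with hz
    set c : Momentum := WithLp.toLp 2 fun i => (z i : ℝ) * (2 * Real.pi) with hc
    have hev1 : ∀ i : Fin 2, ∀ᶠ q' : Momentum in 𝓝 q,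
        toIocMod Real.two_pi_pos (-Real.pi) (WithLp.ofLp q' i) = WithLp.ofLp q' i - (z i : ℝ) * (2 * Real.pi) := by
      intro i
      have hcont : ContinuousAt (fun q' : Momentum => WithLp.ofLp q' i) q :=
        ((continuous_apply i).comp (PiLp.continuous_ofLp 2 _)).continuousAt
      have h := eventually_toIocMod_eq_sub Real.two_pi_pos (-Real.pi) (hne i)
      have h2 := hcont.eventually h
      filter_upwards [h2] with q' hq'
      rw [hq', zsmul_eq_mul]
    have hevall : ∀ᶠ q' : Momentum in 𝓝 q, ∀ i : Fin 2,
        toIocMod Real.two_pi_pos (-Real.pi) (WithLp.ofLp q' i) = WithLp.ofLp q' i - (z i : ℝ) * (2 * Real.pi) :=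
      Filter.eventually_all.mpr hev1
    set S₀ : Momentum → ℝ := fun q' => (1 - salmhoferCutoff (100 * (sqDispersion (WithLp.ofLp q') - μ) ^ 2)) *
      g (polarAngle (WithLp.ofLp q')) with hS₀def
    have hev : (fun q : Momentum => m + (1 - salmhoferCutoff (100 * (sqDispersion (WithLp.ofLp q) - μ) ^ 2)) *
          g (polarAngle (fun i => toIocMod Real.two_pi_pos (-Real.pi) (WithLp.ofLp q i)))) =ᶠ[𝓝 q]
        fun q' => m + S₀ (q' - c) := by
      filter_upwards [hevall] with q' hq'
      have hcen : (fun i => toIocMod Real.two_pi_pos (-Real.pi) (WithLp.ofLp q' i)) = WithLp.ofLp (q' - c) := by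
        funext i; rw [hq' i, WithLp.ofLp_sub, Pi.sub_apply, hc, WithLp.ofLp_toLp]
      rw [hS₀def]
      simp only
      rw [hcen, WithLp.ofLp_sub, hc, WithLp.ofLp_toLp]
      congr 2
      rw [show (WithLp.ofLp q' - fun i => (z i : ℝ) * (2 * Real.pi)) = fun i => WithLp.ofLp q' i - (z i : ℝ) * (2 * Real.pi)
        from rfl, sqDispersion_sub_zsmul_two_pi]
    rw [(hev.iteratedFDeriv ℝ n).eq_of_nhds]
    have hq0 : q - c ≠ 0 := by
      intro h0
      have hq' := hevall.self_of_nhds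
      have hzero : (fun i => toIocMod Real.two_pi_pos (-Real.pi) (WithLp.ofLp q i)) = 0 := by
        funext i; rw [hq' i]
        have := congrArg (fun v : Momentum => WithLp.ofLp v i) h0
        simpa [hc] using this
      have h4 : sqDispersion (fun i => toIocMod Real.two_pi_pos (-Real.pi) (WithLp.ofLp q i)) = -4 := by
        rw [hzero]; simp [sqDispersion]; norm_num
      rw [sqDispersion_centred] at h4
      linarith
    have hS₀c : ContDiffAt ℝ (n : WithTop ℕ∞) S₀ (q - c) := by
      have h1 : ContDiffAt ℝ (n : WithTop ℕ∞) (fun q' : Momentum =>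
          1 - salmhoferCutoff (100 * (sqDispersion (WithLp.ofLp q') - μ) ^ 2)) (q - c) := by
        have hψ : ContDiff ℝ (n : WithTop ℕ∞) (fun u : ℝ => 1 - salmhoferCutoff (100 * (u - μ) ^ 2)) := by
          have h := contDiff_flatProfile μ (n := (n : ℕ∞)); exact_mod_cast h
        exact (hψ.comp contDiff_sqDispersion_ofLp).contDiffAt
      exact h1.mul (contDiffAt_comp_polarAngle_ofLp (hgc.of_le hn) hgp hq0)
    have hshift : ContDiffAt ℝ (n : WithTop ℕ∞) (fun q' : Momentum => S₀ (q' - c)) q := by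
      have : ContDiffAt ℝ (n : WithTop ℕ∞) S₀ ((fun q' : Momentum => q' - c) q) := hS₀c
      exact this.comp q (contDiff_id.sub contDiff_const).contDiffAt
    have hconst : ContDiffAt ℝ (n : WithTop ℕ∞) (fun _ : Momentum => m) q := contDiffAt_const
    rw [show (fun q' : Momentum => m + S₀ (q' - c)) = (fun _ : Momentum => m) + fun q' => S₀ (q' - c) from rfl,
      iteratedFDeriv_add_apply hconst hshift, iteratedFDeriv_comp_sub]
    refine (norm_add_le _ _).trans (add_le_add ?_ (hS₀ (q - c)))
    rcases Nat.eq_zero_or_pos n with rfl | hpos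
    · simp only [iteratedFDeriv_zero_eq_comp, Function.comp_apply, LinearIsometryEquiv.norm_map, Real.norm_eq_abs, if_true]
      exact le_rfl
    · rw [iteratedFDeriv_const_of_ne (by omega), Pi.zero_apply, norm_zero, if_neg (by omega)]

/-- **THE GRADED GLOBAL SIZES OF THE MEAN-FREE G-EXTENSION** (the `hB` of `flowPiece_reading_remainder_jets_meanFree_bell` /
`…_oneCall_bell`, linear in each angular jet size).  For `μ ∈ klWindowC`, `f` `C⁴` and `2π`-periodic with `|f − mean f| ≤ b 0` and `‖Dᵏf‖ ≤ b k`
(`1 ≤ k ≤ 4`), and every `i ≤ 4`, every momentum `y`: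
`‖Dⁱ onM(E_μ(f − mean f))(y)‖ ≤ Σ_{j ≤ i} C(i,j)·X j·Ang (i−j)`, `X = (1, 640/3, 1205120/9, 23040401280, 1512668168424320/9)`,
`Ang = (b 0, b 1/r, (b 2+b 1)/r², (b 3+3b 2+2b 1)/r³, (b 4+6b 3+11b 2+6b 1)/r⁴)`, `r = 8/5`. -/
theorem norm_iteratedFDeriv_onM_klFrameExtFn_meanFree_le_graded (hf : ContDiff ℝ 4 f) (hper : Function.Periodic f (2 * Real.pi))
    {μ : ℝ} (hμ : μ ∈ klWindowC) {b : ℕ → ℝ} (hb0 : ∀ t, |f t - klAngularMean f| ≤ b 0)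
    (hb : ∀ k, 1 ≤ k → k ≤ 4 → ∀ t, ‖iteratedFDeriv ℝ k f t‖ ≤ b k) {i : ℕ} (hi : i ≤ 4) (y : Momentum) :
    ‖iteratedFDeriv ℝ i (onM (klFrameExtFn μ fun t => f t - klAngularMean f)) y‖ ≤
      ∑ j ∈ range (i + 1), (i.choose j : ℝ) *
        ((fun j : ℕ => if j = 0 then (1 : ℝ) else if j = 1 then 640 / 3 else if j = 2 then 1205120 / 9 else if j = 3 then 23040401280
          else 1512668168424320 / 9) j) *
        ((fun m : ℕ => if m = 0 then b 0 else if m = 1 then b 1 / (8 / 5) else if m = 2 then (b 2 + b 1) / (8 / 5) ^ 2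
          else if m = 3 then (b 3 + 3 * b 2 + 2 * b 1) / (8 / 5) ^ 3 else (b 4 + 6 * b 3 + 11 * b 2 + 6 * b 1) / (8 / 5) ^ 4) (i - j)) := by
  set g : ℝ → ℝ := fun t => f t - klAngularMean f with hgdef
  have hfi : IntervalIntegrable f MeasureTheory.volume 0 (2 * π) := hf.continuous.intervalIntegrable _ _
  have hgc : ContDiff ℝ 4 g := hf.sub contDiff_const
  have hgp : Function.Periodic g (2 * Real.pi) := fun t => by simp [hgdef, hper t]
  have hmean : klAngularMean g = 0 := klAngularMean_sub_mean f hfi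
  -- jets of `g`: order 0 from `hb0`, orders ≥ 1 are those of `f`
  have hgb : ∀ k, 1 ≤ k → k ≤ 4 → ∀ t, ‖iteratedFDeriv ℝ k g t‖ ≤ b k := by
    intro k hk1 hk4 t
    rw [hgdef, norm_iteratedFDeriv_sub_const_of_one_le f _ hk1]
    exact hb k hk1 hk4 t
  have hgb0 : ∀ t, |g t| ≤ b 0 := hb0
  -- the symbol bound for `g − mean g = g`
  have hS := fun q' : Momentum => norm_iteratedFDeriv_flatSymbol_le_graded hgc hgp hμ hgb0 hgb hi q'
  rw [onM_klFrameExtFn_eq, hmean]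
  have hb00 : 0 ≤ b 0 := (abs_nonneg _).trans (hb0 0)
  have hb1 : 0 ≤ b 1 := (norm_nonneg _).trans (hb 1 le_rfl (by norm_num) 0)
  have hb2 : 0 ≤ b 2 := (norm_nonneg _).trans (hb 2 (by norm_num) (by norm_num) 0)
  have hb3 : 0 ≤ b 3 := (norm_nonneg _).trans (hb 3 (by norm_num) (by norm_num) 0)
  have hb4 : 0 ≤ b 4 := (norm_nonneg _).trans (hb 4 (by norm_num) le_rfl 0)
  have hsum0 : 0 ≤ ∑ j ∈ range (i + 1), (i.choose j : ℝ) *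
        ((fun j : ℕ => if j = 0 then (1 : ℝ) else if j = 1 then 640 / 3 else if j = 2 then 1205120 / 9 else if j = 3 then 23040401280
          else 1512668168424320 / 9) j) *
        ((fun m : ℕ => if m = 0 then b 0 else if m = 1 then b 1 / (8 / 5) else if m = 2 then (b 2 + b 1) / (8 / 5) ^ 2
          else if m = 3 then (b 3 + 3 * b 2 + 2 * b 1) / (8 / 5) ^ 3 else (b 4 + 6 * b 3 + 11 * b 2 + 6 * b 1) / (8 / 5) ^ 4) (i - j)) := by
    refine sum_nonneg fun j _ => ?_
    beta_reduce
    refine mul_nonneg (mul_nonneg (by positivity) ?_) ?_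
    · split_ifs <;> norm_num
    · split_ifs <;> positivity
  have hS' : ∀ q' : Momentum, ‖iteratedFDeriv ℝ i (fun q' : Momentum =>
      (1 - salmhoferCutoff (100 * (sqDispersion (WithLp.ofLp q') - μ) ^ 2)) * (g (polarAngle (WithLp.ofLp q')) - 0)) q'‖ ≤
      ∑ j ∈ range (i + 1), (i.choose j : ℝ) *
        ((fun j : ℕ => if j = 0 then (1 : ℝ) else if j = 1 then 640 / 3 else if j = 2 then 1205120 / 9 else if j = 3 then 23040401280
          else 1512668168424320 / 9) j) *
        ((fun m : ℕ => if m = 0 then b 0 else if m = 1 then b 1 / (8 / 5) else if m = 2 then (b 2 + b 1) / (8 / 5) ^ 2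
          else if m = 3 then (b 3 + 3 * b 2 + 2 * b 1) / (8 / 5) ^ 3 else (b 4 + 6 * b 3 + 11 * b 2 + 6 * b 1) / (8 / 5) ^ 4) (i - j)) := by
    intro q'; simp only [sub_zero]; exact hS q'
  have h := norm_iteratedFDeriv_frameExtFn_le_of_symbolBound (N := 4) hgc hgp (n := i) (by exact_mod_cast hi) (m := 0) hμ hsum0 hS' y
  simp only [abs_zero, ite_self, zero_add, sub_zero] at h
  simpa [sub_zero] using h

end Main

end Summit.HubbardSuperconductivity.HubbardSuperconductivity.Theorems.KLRegimeSplit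

end
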